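import Literature.AlgebraicGeometry.Limits.SubalgebraEndomorphismSpread
import Mathlib.LinearAlgebra.FreeModule.Finite.Basic
import Mathlib.CategoryTheory.Monoidal.Cartesian.Grp
import HarnessLib

/-!
# Limits of schemes: a commutative group law and a ring of endomorphisms over `Spec B`, `B = ⋃ K[t]`, descend
# together to every sufficiently fine stage (EGA IV₃ 8.8.2 (i); Stacks 01ZC, 01ZM)

Topic `Literature/AlgebraicGeometry/Limits`; sequel of `Limits/SubalgebraGroupSpread` and
`Limits/SubalgebraEndomorphismSpread` (notation as there).  For a `K`-scheme `P` (quasi-compact, separated, flat,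
locally of finite presentation), a reduced `K`-algebra `B`, a COMMUTATIVE group-scheme structure on
`P_B = P ×_K Spec B` and an action `ι : O → End(P_B)` of a commutative ring `O` whose additive group is free of
finite rank (e.g. an order `𝓞_K` of a number field) by homomorphisms — `ι 1 = 𝟙`, `ι (ab) = ι a ∘ ι b`,
`ι (a + b) = ι a · ι b` (product of homomorphisms into the commutative group scheme) — there is a stage `t₁` such
that on EVERY finer stage `P_t = P ×_K Spec K[t]` the group law descends to a commutative group-scheme structure
(`GrpSpread.grpObj`) and the action descends to `ι_t : O → End(P_t)` with the same three identities, each `ι_t a` a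
homomorphism, and `(ι_t a)_B = ι a` under `(P_t)_B ≅ P_B` (`exists_stage_forall_grpObj_ringAction`).  The proof
lifts the action of a `ℤ`-basis of `O` (`exists_stage_forall_map_eq_conj`), extends multiplicatively
(`ι_t a = ∏ᵢ ψᵢ^{aᵢ}` in the commutative group `Hom(P_t, P_t)`), and transfers the identities from `Spec B` by the
injectivity of restriction (`stage_hom_ext_of_map_eq`).

Use (cell `hodgecm-mathlib`, row II-2β `shimura1998_prop26_definedOverQbar`, (S1)): `O = 𝓞_K` acting on a CM
abelian variety `A/ℂ`, `K` the base of its smooth projective spread, `B = ℂ`.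

## References
* [EGAIV3] A. Grothendieck, EGA IV₃ (Publ. Math. IHÉS 28, 1966), Thm. 8.8.2 (i).
* [StacksProject] The Stacks project, Tags 01ZC, 01ZM.
* [Milne1986AbelianVarieties] J. S. Milne, *Abelian Varieties* (1986), §20, proof of Cor. 20.4 / Rem. 20.9
  («defined over a subfield finitely generated over the prime field»).
-/

noncomputable section

universe u

open CategoryTheory CategoryTheory.Limits AlgebraicGeometry MonoidalCategory
  CartesianMonoidalCategory MonObj
open Functor.LaxMonoidal Functor.OplaxMonoidal

namespace Literature.AlgebraicGeometry.Limits

/-! ## §1 Commutativity for a lifted group structure; transport along isomorphisms -/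

section Transfer

universe v₁ v₂ u₁ u₂

variable {C : Type u₁} [Category.{v₁} C] [CartesianMonoidalCategory C] [BraidedCategory C]
  {D : Type u₂} [Category.{v₂} D] [CartesianMonoidalCategory D] [BraidedCategory D]

/-- In a cartesian monoidal category every braiding is the flip `(pr₂, pr₁)`. [folklore] -/
@[reassoc]
private theorem braiding_hom_eq_lift (X Y : C) : (β_ X Y).hom = lift (snd X Y) (fst X Y) := by
  ext
  · rw [braiding_hom_fst, lift_fst]
  · rw [braiding_hom_snd, lift_snd]

/-- An oplax monoidal functor between cartesian monoidal categories commutes with the flips: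
`F(β) ≫ δ = δ ≫ β`. [folklore] -/
@[reassoc]
private theorem map_braiding_hom_comp_δ (F : C ⥤ D) [F.OplaxMonoidal] (X Y : C) :
    F.map (β_ X Y).hom ≫ δ F Y X = δ F X Y ≫ (β_ (F.obj X) (F.obj Y)).hom := by
  rw [braiding_hom_eq_lift, braiding_hom_eq_lift, lift_δ, comp_lift, δ_fst, δ_snd]

variable {F : C ⥤ D} [F.Monoidal] {N : C} [GrpObj (F.obj N)] {P : C → Prop}

/-- **The lifted group structure is commutative if the given one is**: `β ≫ μ = μ` is an equality of maps
`N ⊗ N ⟶ N` holding after `F`. [cite: EGAIV3, Thm. 8.8.2 (i)] -/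
theorem LiftedGrpData.isCommMonObj_of (h : LiftedGrpData F N P) [IsCommMonObj (F.obj N)] :
    letI : GrpObj N := h.grpObj
    IsCommMonObj N := by
  letI : GrpObj N := h.grpObj
  refine { mul_comm := ?_ }
  refine h.map_injective (h.tensor _ _ h.self h.self) ?_
  change F.map ((β_ N N).hom ≫ h.mul) = F.map h.mul
  rw [F.map_comp, h.map_mul, map_braiding_hom_comp_δ_assoc, IsCommMonObj.mul_comm]

omit [CartesianMonoidalCategory C] in
/-- Transport of commutativity along `MonObj.ofIso`. [folklore] -/
private theorem isCommMonObj_ofIso [MonoidalCategory C] [BraidedCategory C] {M X : C} [MonObj M] [IsCommMonObj M]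
    (e : M ≅ X) : letI := MonObj.ofIso e; IsCommMonObj X := by
  letI := MonObj.ofIso e
  refine { mul_comm := ?_ }
  rw [MonObj.ofIso_mul, ← Category.assoc, ← BraidedCategory.braiding_naturality, Category.assoc,
    IsCommMonObj.mul_comm_assoc]

end Transfer

namespace SubalgGrpSpread

open Literature.AlgebraicGeometry.Motives (SchemeOver specOver)
open SubalgApprox

set_option backward.isDefEq.respectTransparency false

variable {K : Type u} [CommRing K] {B : Type u} [CommRing B] [Algebra K B] {s₁ : Finset B}
  {P : SchemeOver K} {t : (Idx B s₁)ᵒᵖ} [GrpObj (limObj B P)]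
  [Flat (stageObj B s₁ P t).hom] [IsSeparated (stageObj B s₁ P t).hom]
  [IsSchemeTheoreticallyDominant (baseLeg K B s₁ t).left]

/-! ## §2 The descended group law on a stage: commutativity, products of endomorphisms -/

/-- **The descended group law is commutative when `P_B` is.** [cite: EGAIV3, Thm. 8.8.2 (i)] -/
theorem GrpSpread.isCommMonObj (d : GrpSpread B s₁ P t) [IsCommMonObj (limObj B P)] :
    letI : GrpObj (stageObj B s₁ P t) := d.grpObj
    IsCommMonObj (stageObj B s₁ P t) := by
  letI := grpObjLegObj (B := B) (s₁ := s₁) (P := P) t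
  haveI : IsCommMonObj ((legPullback K B s₁ t).obj (stageObj B s₁ P t)) :=
    isCommMonObj_ofIso (legFacObjIso B s₁ t P).symm
  exact d.liftedGrpData.isCommMonObj_of

/-- **Restriction to `Spec B` is multiplicative on endomorphisms**: for the descended group law on `P_t` and the
transported one on `(P_t)_B`, `(ψ · ψ')_B = ψ_B · ψ'_B` (products of maps into a group object). [cite: EGAIV3, Thm. 8.8.2 (i)] -/
theorem GrpSpread.map_hom_mul (d : GrpSpread B s₁ P t) (ψ ψ' : stageObj B s₁ P t ⟶ stageObj B s₁ P t) :
    letI : GrpObj (stageObj B s₁ P t) := d.grpObj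
    letI := grpObjLegObj (B := B) (s₁ := s₁) (P := P) t
    (legPullback K B s₁ t).map (ψ * ψ') = (legPullback K B s₁ t).map ψ * (legPullback K B s₁ t).map ψ' := by
  letI : GrpObj (stageObj B s₁ P t) := d.grpObj
  letI := grpObjLegObj (B := B) (s₁ := s₁) (P := P) t
  rw [Hom.mul_def, Hom.mul_def, Functor.map_comp]
  change (legPullback K B s₁ t).map (lift ψ ψ') ≫ (legPullback K B s₁ t).map d.mul = _
  rw [d.map_mul, lift_δ_assoc]

omit [Flat (stageObj B s₁ P t).hom] [IsSeparated (stageObj B s₁ P t).hom]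
  [IsSchemeTheoreticallyDominant (baseLeg K B s₁ t).left] in
/-- Conjugation by the group isomorphism `(P_t)_B ≅ P_B` is multiplicative (products of homomorphisms into the group
object `P_B`, resp. `(P_t)_B`). [cite: EGAIV3, Thm. 8.8.2 (i)] -/
theorem conj_hom_mul (φ φ' : limObj B P ⟶ limObj B P) :
    letI := grpObjLegObj (B := B) (s₁ := s₁) (P := P) t
    (legFacObjIso B s₁ t P).hom ≫ (φ * φ') ≫ (legFacObjIso B s₁ t P).inv =
      ((legFacObjIso B s₁ t P).hom ≫ φ ≫ (legFacObjIso B s₁ t P).inv) *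
        ((legFacObjIso B s₁ t P).hom ≫ φ' ≫ (legFacObjIso B s₁ t P).inv) := by
  letI := grpObjLegObj (B := B) (s₁ := s₁) (P := P) t
  haveI : IsMonHom (legFacObjIso B s₁ t P).symm.hom := isMonHom_ofIso (legFacObjIso B s₁ t P).symm
  haveI : IsMonHom (legFacObjIso B s₁ t P).inv :=
    inferInstanceAs (IsMonHom (legFacObjIso B s₁ t P).symm.hom)
  rw [MonObj.mul_comp, MonObj.comp_mul]


/-! ## §3 The group law and a ring action descend together to every fine stage -/

section Main

variable (B s₁ P)
variable [IsReduced B] [QuasiCompact P.hom] [IsSeparated P.hom] [Flat P.hom]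
  [LocallyOfFinitePresentation P.hom] [IsCommMonObj (limObj B P)]
  {O : Type*} [CommRing O] [Module.Free ℤ O] [Module.Finite ℤ O]

omit [Flat (stageObj B s₁ P t).hom] [IsSeparated (stageObj B s₁ P t).hom]
  [IsSchemeTheoreticallyDominant (baseLeg K B s₁ t).left] in
/-- **A commutative group law on `P_B` and an action `ι : O → End(P_B)` by homomorphisms of a commutative ring `O`
free of finite rank over `ℤ` descend together to every sufficiently fine stage `P_t`** (EGA IV₃ 8.8.2 (i) / Stacks
01ZC–01ZM for the diagrams of a commutative group object and of finitely many endomorphisms with their relations;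
Milne, *Abelian Varieties* §20: «`A` [with its endomorphisms] is defined over a subfield finitely generated over the
prime field»).  Hypotheses: `P → Spec K` quasi-compact, separated, flat, locally of finite presentation; `B` reduced;
`ι 1 = 𝟙`, `ι (aa′) = ι a ∘ ι a′`, `ι (a + a′) = ι a · ι a′`.  Conclusion: a stage `t₁` (below any prescribed `t₀`)
such that for every `t ⊇ t₁` the stage `P_t` carries a COMMUTATIVE group-scheme structure and a map
`ι_t : O → End(P_t)` with the same three identities, each `ι_t a` a homomorphism, the canonical `(P_t)_B ≅ P_B` an
isomorphism of group schemes, and `(ι_t a)_B = ι a` under it.  Proof: spread the group law (`exists_grpSpread`)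
and the action of a `ℤ`-basis of `O` (`exists_stage_forall_map_eq_conj`), extend `ℤ`-linearly into the commutative
group `Hom(P_t, P_t)`, and transfer the identities from `Spec B` by injectivity of restriction.
[cite: EGAIV3, Thm. 8.8.2 (i)] [cite: StacksProject, Tags 01ZC and 01ZM] [cite: Milne1986AbelianVarieties, §20 Rem. 20.9] -/
theorem exists_stage_forall_grpObj_ringAction (ιB : O → (limObj B P ⟶ limObj B P))
    [∀ a, IsMonHom (ιB a)] (h1 : ιB 1 = 𝟙 _) (hmul : ∀ a a', ιB (a * a') = ιB a ≫ ιB a')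
    (hadd : ∀ a a', ιB (a + a') = ιB a * ιB a') (t₀ : (Idx B s₁)ᵒᵖ) :
    ∃ (t₁ : (Idx B s₁)ᵒᵖ) (_ : t₁ ⟶ t₀), ∀ (t : (Idx B s₁)ᵒᵖ) (_ : t ⟶ t₁),
      ∃ (G : GrpObj (stageObj B s₁ P t)) (ιt : O → (stageObj B s₁ P t ⟶ stageObj B s₁ P t)),
        letI : GrpObj (stageObj B s₁ P t) := G
        IsCommMonObj (stageObj B s₁ P t) ∧ (∀ a, IsMonHom (ιt a)) ∧ ιt 1 = 𝟙 _ ∧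
        (∀ a a', ιt (a * a') = ιt a ≫ ιt a') ∧ (∀ a a', ιt (a + a') = ιt a * ιt a') ∧
        @IsMonHom _ _ _ _ _ (Functor.monObjObj (F := legPullback K B s₁ t) (stageObj B s₁ P t))
          inferInstance (legFacObjIso B s₁ t P).hom ∧
        ∀ a, (legPullback K B s₁ t).map (ιt a) =
          (legFacObjIso B s₁ t P).hom ≫ ιB a ≫ (legFacObjIso B s₁ t P).inv := by
  classical
  haveI : QuasiSeparated P.hom := inferInstance
  -- the group law spreads to a stage `t₂`; refine with `t₀`
  obtain ⟨t₂, ⟨d₂⟩⟩ := exists_grpSpread B s₁ P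
  obtain ⟨t₃, ⟨ρ₃₀⟩, ⟨ρ₃₂⟩⟩ := exists_hom₂ B s₁ t₀ t₂
  -- a `ℤ`-basis of `O`; its action lifts to a stage `t₁ ≤ t₃`
  let b := Module.Free.chooseBasis ℤ O
  obtain ⟨t₁, ρ₁, ψ, hψ⟩ :=
    exists_stage_forall_map_eq_conj (B := B) (s₁ := s₁) (P := P) t₃ fun i => ιB (b i)
  refine ⟨t₁, ρ₁ ≫ ρ₃₀, fun t ρ => ?_⟩
  -- the stage `t`: flat, separated, schematically dominated by `Spec B`; the descended group law
  haveI : Flat (stageObj B s₁ P t).hom :=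
    inferInstanceAs (Flat (pullback.snd P.hom ((baseDiagram K B s₁).obj t).hom))
  haveI : IsSeparated (stageObj B s₁ P t).hom :=
    inferInstanceAs (IsSeparated (pullback.snd P.hom ((baseDiagram K B s₁).obj t).hom))
  let d : GrpSpread B s₁ P t := d₂.restrict (ρ ≫ ρ₁ ≫ ρ₃₂)
  letI : GrpObj (stageObj B s₁ P t) := d.grpObj
  haveI hcomm : IsCommMonObj (stageObj B s₁ P t) := d.isCommMonObj
  letI := grpObjLegObj (B := B) (s₁ := s₁) (P := P) t
  -- lifts of the basis action, restricted to the stage `t`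
  let ψt : Module.Free.ChooseBasisIndex ℤ O → (stageObj B s₁ P t ⟶ stageObj B s₁ P t) := fun i =>
    sliceHom ((baseDiagram K B s₁).obj t)
      ((P ◁ (baseDiagram K B s₁).map ρ) ≫ unsliceHom ((baseDiagram K B s₁).obj t₁) (ψ i))
  have hψt : ∀ i, (legPullback K B s₁ t).map (ψt i) =
      (legFacObjIso B s₁ t P).hom ≫ ιB (b i) ≫ (legFacObjIso B s₁ t P).inv := fun i =>
    map_restrictStage_eq_conj ρ (ιB (b i)) (ψ i) (hψ i)
  -- the action on the stage: the `ℤ`-linear extension `ι_t a = ∏ᵢ ψᵢ^{aᵢ}` into the commutative group `Hom(P_t, P_t)`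
  let L : O →ₗ[ℤ] Additive (stageObj B s₁ P t ⟶ stageObj B s₁ P t) :=
    b.constr ℤ fun i => Additive.ofMul (ψt i)
  let ιt : O → (stageObj B s₁ P t ⟶ stageObj B s₁ P t) := fun a => Additive.toMul (L a)
  have hιt_add : ∀ a a', ιt (a + a') = ιt a * ιt a' := fun a a' => by
    simp only [ιt, map_add, toMul_add]
  have hιt_b : ∀ i, ιt (b i) = ψt i := fun i => by
    simp only [ιt, L, Module.Basis.constr_basis, toMul_ofMul]
  -- KEY: `(ι_t a)_B = e ∘ ι a ∘ e⁻¹` for all `a`: two additive maps `O → Hom((P_t)_B, (P_t)_B)` agreeing on `b`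
  have hgen : AddSubgroup.closure (Set.range b) = ⊤ := by
    rw [← Submodule.span_int_eq_addSubgroupClosure, b.span_eq, Submodule.top_toAddSubgroup]
  let L₁ : O →+ Additive ((legPullback K B s₁ t).obj (stageObj B s₁ P t) ⟶
      (legPullback K B s₁ t).obj (stageObj B s₁ P t)) :=
    AddMonoidHom.mk' (fun a => Additive.ofMul ((legPullback K B s₁ t).map (ιt a))) fun a a' => by
      rw [hιt_add, d.map_hom_mul]; rfl
  let L₂ : O →+ Additive ((legPullback K B s₁ t).obj (stageObj B s₁ P t) ⟶
      (legPullback K B s₁ t).obj (stageObj B s₁ P t)) :=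
    AddMonoidHom.mk' (fun a => Additive.ofMul
      ((legFacObjIso B s₁ t P).hom ≫ ιB a ≫ (legFacObjIso B s₁ t P).inv)) fun a a' => by
      rw [hadd, conj_hom_mul]; rfl
  have hL : L₁ = L₂ := by
    refine AddMonoidHom.eq_of_eqOn_dense hgen ?_
    rintro _ ⟨i, rfl⟩
    change Additive.ofMul ((legPullback K B s₁ t).map (ιt (b i))) =
      Additive.ofMul ((legFacObjIso B s₁ t P).hom ≫ ιB (b i) ≫ (legFacObjIso B s₁ t P).inv)
    rw [hιt_b, hψt]
  have hkey : ∀ a, (legPullback K B s₁ t).map (ιt a) =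
      (legFacObjIso B s₁ t P).hom ≫ ιB a ≫ (legFacObjIso B s₁ t P).inv := fun a =>
    congrArg Additive.toMul (DFunLike.congr_fun hL a)
  -- the identities transfer from `Spec B`
  refine ⟨d.grpObj, ιt, hcomm, fun a => d.isMonHom_of_map_eq_conj (ιB a) (ιt a) (hkey a),
    ?_, fun a a' => ?_, hιt_add, d.isMonHom_legFacObjIso_hom, hkey⟩
  · exact stage_hom_ext_of_map_eq (by rw [hkey, h1, map_id_eq_conj])
  · exact (comp_eq_of_map_eq_conj (hkey a) (hkey a') (hkey (a * a')) (hmul a a').symm).symm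

end Main

end SubalgGrpSpread

end Literature.AlgebraicGeometry.Limits

end
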